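import Summits.AnomalousDissipation.AnomalousDissipation.Theorems.EulerLimitEulerlimitThesisV2KrCellCauchy
import HarnessLib

/-!
# Stub `stub_krTimeModesCauchy` (H3) of the plan for `stub_kolmogorovRieszPeriodicSlab`
(line `tight`, crux `EulerLimit.EulerlimitThesisV2`, stmt-AnomalousDissipation-0511)

**One subsequence along which every spatial Fourier mode is Cauchy in `L³(0,T)`, from a uniform
time-modulus of continuity.**  This is the modulus analogue of the tree's
`Literature.Analysis.FluidPDE.exists_subseq_forall_modes_cauchy_L3` (`ClassicalNSModeCompactness`;
the time-direction half of the Aubin–Lions–Simon step of De Rosa–Isett 2024, §6.1, on the Fourier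
side; Simon 1987, §8, Thm. 5): there the increments of the coefficient functions were controlled by
integrable rates coming from the Navier–Stokes equations; here no equation is used — the family
`u_j`, jointly smooth on `ℝ × T^d` and bounded in `L³((0,T) × T^d)`, is assumed to have a uniform
`L³` modulus of continuity under TIME translations, which passes to every Fourier mode
(`|ŵ(k)| ≤ ‖w‖_{L¹} ≤ ‖w‖_{L³}` on the torus).  The cell averages of the modes over all cells of all
uniform partitions are bounded by `B + T`, one diagonal subsequence makes all of them converge
(`exists_strictMono_forall_tendsto`), and `stub_krCellCauchy`'s
`exists_forall_lintegral_enorm_sub_pow_three_le_of_modulus` concludes, one frequency at a time.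
Generic in `d`; the file ends with the REGISTERED sub-stub `stub_krTimeModesCauchy` (`d = Fin 3`),
signature verbatim.
-/

noncomputable section

-- D-0017: single-problem summit ⇒ the duplicated namespace segment is by design.
set_option linter.dupNamespace false

open MeasureTheory Set Function Filter UnitAddTorus Metric
open scoped ENNReal NNReal Topology

namespace Summit.AnomalousDissipation.AnomalousDissipation.Theorems.EulerLimitKR

open Literature.Analysis.FunctionSpaces Literature.Analysis.FunctionSpaces.Torus
  Literature.Analysis.FluidPDE

/-- **A subsequence along which every Fourier mode is Cauchy in `L³(0,T)`, from the time modulus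
(H3)** (modulus analogue of `FluidPDE.exists_subseq_forall_modes_cauchy_L3`; Simon 1987, §8,
Thm. 5; De Rosa–Isett 2024, §6.1).  Let `u_j` be jointly smooth on `ℝ × T^d` with
`∫₀ᵀ∫ ‖u_j‖³ ≤ B < ∞` and a uniform `L³((0,T) × T^d)` modulus of continuity under time translations.
Then there is a strictly increasing `φ` such that for every frequency `k` and every `η > 0` there is
`N` with `∫₀ᵀ ‖û_{φ n}(t,k) - û_{φ m}(t,k)‖³ dt ≤ η` for all `n, m ≥ N`. [cite: Simon1986, §8 Thm. 5] -/
theorem exists_subseq_forall_modes_cauchy_L3_of_modulus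
    {d : Type*} [Fintype d] {T : ℝ} (hT : 0 < T)
    {u : ℕ → ℝ → UnitAddTorus d → EuclideanSpace ℝ d}
    (hu : ∀ j, IsSmoothSpaceTimeOn univ (u j))
    {B : ℝ≥0∞} (hB : B ≠ ⊤) (hL3 : ∀ j, ∫⁻ t in Ioo 0 T, ∫⁻ x, ‖u j t x‖ₑ ^ 3 ≤ B)
    (hmod : ∀ Λ : ℝ≥0∞, 0 < Λ → ∃ δ : ℝ, 0 < δ ∧ ∀ (j : ℕ) (σ : ℝ), |σ| ≤ δ →
      ∫⁻ t in Ioo 0 T, ∫⁻ x, ‖u j (t + σ) x - u j t x‖ₑ ^ 3 ≤ Λ) :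
    ∃ φ : ℕ → ℕ, StrictMono φ ∧ ∀ (k : d → ℤ) (η : ℝ≥0∞), 0 < η → ∃ N : ℕ, ∀ n m : ℕ,
      N ≤ n → N ≤ m →
        ∫⁻ t in Ioo 0 T, ‖mFourierCoeff (EuclideanSpace.complexify ∘ u (φ n) t) k -
          mFourierCoeff (EuclideanSpace.complexify ∘ u (φ m) t) k‖ₑ ^ 3 ≤ η := by
  -- notation
  set F : ℕ → (d → ℤ) → ℝ → EuclideanSpace ℂ d :=
    fun j k t => mFourierCoeff (EuclideanSpace.complexify ∘ u j t) k with hF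
  set R : ℝ := B.toReal + T with hR
  have hsm : ∀ j, IsSmoothSpaceTimeOn (Ioo 0 T) (u j) := fun j => (hu j).mono (subset_univ _)
  have hslice : ∀ j s, IsSmooth (u j s) := fun j s => (hu j).isSmooth_slice (mem_univ s)
  -- continuity in time of the modes
  have hFc : ∀ j k, Continuous (F j k) := fun j k =>
    continuousOn_univ.1
      (continuousOn_mFourierCoeff_of_continuousOn_stLift (hu j).continuousOn_stLift k)
  -- the modulus of a mode is controlled by the modulus of the field
  have hmode_pt : ∀ j k s t, ‖F j k s - F j k t‖ₑ ^ 3 ≤ ∫⁻ x, ‖u j s x - u j t x‖ₑ ^ 3 := by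
    intro j k s t
    have hws : Continuous fun x => u j s x - u j t x :=
      (hslice j s).continuous.sub (hslice j t).continuous
    have e1 : F j k s - F j k t =
        mFourierCoeff (EuclideanSpace.complexify ∘ fun x => u j s x - u j t x) k := by
      simp only [hF]
      have e2 : (EuclideanSpace.complexify ∘ fun x => u j s x - u j t x) =
          EuclideanSpace.complexify ∘ u j s - EuclideanSpace.complexify ∘ u j t := by
        funext y
        simp [map_sub]
      rw [e2, mFourierCoeff_sub]
      · exact EuclideanSpace.complexify.toContinuousLinearMap.integrable_comp (hslice j s).integrable
      · exact EuclideanSpace.complexify.toContinuousLinearMap.integrable_comp (hslice j t).integrable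
    have h1 : ‖F j k s - F j k t‖ ≤ ∫ x, ‖u j s x - u j t x‖ := by
      rw [e1]
      exact norm_mFourierCoeff_complexify_le_integral_norm hws.integrable_unitAddTorus k
    have h2 : ‖F j k s - F j k t‖ₑ ≤ eLpNorm (fun x => u j s x - u j t x) 3 volume := by
      rw [← ofReal_norm]
      refine (ENNReal.ofReal_le_ofReal h1).trans ?_
      rw [← Real.enorm_of_nonneg (integral_nonneg fun _ => norm_nonneg _)]
      exact enorm_integral_norm_le_eLpNorm_three hws
    calc ‖F j k s - F j k t‖ₑ ^ 3 ≤ eLpNorm (fun x => u j s x - u j t x) 3 volume ^ 3 := by gcongr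
      _ = ∫⁻ x, ‖u j s x - u j t x‖ₑ ^ 3 := (lintegral_enorm_pow_three_eq _).symm
  -- uniform bounds: `∫₀ᵀ |F j k| ≤ R`
  have hE1i : ∀ j, IntegrableOn (fun t => ∫ x, ‖u j t x‖) (Ioo 0 T) ∧
      ∫ t in Ioo 0 T, ∫ x, ‖u j t x‖ ≤ R := fun j => by
    have h := integrableOn_integral_norm_pow hT.le (hsm j) hB (hL3 j) (by norm_num : 1 ≤ 3)
    simpa only [pow_one] using h
  have hFi : ∀ j k, IntegrableOn (F j k) (Ioo 0 T) ∧ ∫ t in Ioo 0 T, ‖F j k t‖ ≤ R := fun j k => by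
    obtain ⟨h1, h2⟩ := integrableOn_mFourierCoeff_slice (hsm j) (hE1i j).1 k
    exact ⟨h1, h2.trans (hE1i j).2⟩
  -- cell averages and the diagonal extraction
  set x : ℕ → (d → ℤ) × ℕ × ℕ → EuclideanSpace ℂ d := fun j i =>
    if i.2.2 ≤ i.2.1 then
      ∫ t in Ioo ((i.2.2 : ℝ) * (T / (i.2.1 + 1))) ((i.2.2 + 1 : ℝ) * (T / (i.2.1 + 1))), F j i.1 t
    else 0 with hx
  have hcell : ∀ L l : ℕ, l ≤ L →
      Ioo ((l : ℝ) * (T / (L + 1))) ((l + 1 : ℝ) * (T / (L + 1))) ⊆ Ioo 0 T := by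
    intro L l hl
    have hh : 0 < T / (L + 1) := by positivity
    have hnh : ((L + 1 : ℕ) : ℝ) * (T / (L + 1)) = T := by push_cast; field_simp
    exact Ioo_cell_subset hh hnh (Nat.lt_succ_iff.2 hl)
  have hxb : ∀ j i, ‖x j i‖ ≤ R := by
    intro j i
    obtain ⟨k, L, l⟩ := i
    simp only [hx]
    split_ifs with hl
    · calc ‖∫ t in Ioo ((l : ℝ) * (T / (L + 1))) ((l + 1 : ℝ) * (T / (L + 1))), F j k t‖
          ≤ ∫ t in Ioo ((l : ℝ) * (T / (L + 1))) ((l + 1 : ℝ) * (T / (L + 1))), ‖F j k t‖ :=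
            norm_integral_le_integral_norm _
        _ ≤ ∫ t in Ioo 0 T, ‖F j k t‖ :=
            setIntegral_mono_set (hFi j k).1.norm (ae_of_all _ fun t => norm_nonneg _)
              (hcell L l hl).eventuallyLE
        _ ≤ R := (hFi j k).2
    · rw [norm_zero]
      positivity
  obtain ⟨φ, hφ, hconv⟩ := exists_strictMono_forall_tendsto x fun i =>
    ⟨0, R, fun j => mem_closedBall_zero_iff.2 (hxb j i)⟩
  refine ⟨φ, hφ, fun k η hη => ?_⟩
  have havg : ∀ L l : ℕ, l ≤ L → ∃ c : EuclideanSpace ℂ d, Tendsto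
      (fun n => ∫ t in Ioo ((l : ℝ) * (T / (L + 1))) ((l + 1 : ℝ) * (T / (L + 1))), F (φ n) k t)
        atTop (𝓝 c) := by
    intro L l hl
    obtain ⟨c, hc⟩ := hconv (k, L, l)
    refine ⟨c, ?_⟩
    have hfun : (fun n => x (φ n) (k, L, l)) = fun n =>
        ∫ t in Ioo ((l : ℝ) * (T / (L + 1))) ((l + 1 : ℝ) * (T / (L + 1))), F (φ n) k t := by
      funext n
      simp only [hx, if_pos hl]
    rw [← hfun]
    exact hc
  -- the uniform modulus of the modes along `φ`
  have hmodF : ∀ Λ : ℝ≥0∞, 0 < Λ → ∃ δ : ℝ, 0 < δ ∧ ∀ (n : ℕ) (σ : ℝ), |σ| ≤ δ →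
      ∫⁻ t in Ioo 0 T, ‖F (φ n) k (t + σ) - F (φ n) k t‖ₑ ^ 3 ≤ Λ := by
    intro Λ hΛ
    obtain ⟨δ, hδ, hδ'⟩ := hmod Λ hΛ
    exact ⟨δ, hδ, fun n σ hσ =>
      (lintegral_mono fun t => hmode_pt (φ n) k (t + σ) t).trans (hδ' (φ n) σ hσ)⟩
  exact exists_forall_lintegral_enorm_sub_pow_three_le_of_modulus hT (fun n => hFc (φ n) k)
    hmodF havg hη

/-- **Registered sub-stub `stub_krTimeModesCauchy`** (H3 of the STUB-PLAN for
`stub_kolmogorovRieszPeriodicSlab`, `d = Fin 3`): one subsequence with every spatial Fourier mode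
Cauchy in `L³(0,T)`, from the uniform time-modulus
(`exists_subseq_forall_modes_cauchy_L3_of_modulus`). [cite: Simon1986, §8 Thm. 5] -/
theorem stub_krTimeModesCauchy :
    ∀ (T : ℝ) (B : ENNReal) (u : ℕ → ℝ → UnitAddTorus (Fin 3) → EuclideanSpace ℝ (Fin 3)), 0 < T → B ≠ ⊤ → (∀ j, Literature.Analysis.FunctionSpaces.Torus.IsSmoothSpaceTimeOn Set.univ (u j)) → (∀ j, ∫⁻ t in Set.Ioo 0 T, ∫⁻ x, ‖u j t x‖ₑ ^ 3 ≤ B) → (∀ Λ : ENNReal, 0 < Λ → ∃ δ : ℝ, 0 < δ ∧ ∀ (j : ℕ) (σ : ℝ), |σ| ≤ δ → ∫⁻ t in Set.Ioo 0 T, ∫⁻ x, ‖u j (t + σ) x - u j t x‖ₑ ^ 3 ≤ Λ) → ∃ φ : ℕ → ℕ, StrictMono φ ∧ ∀ (k : Fin 3 → ℤ) (η : ENNReal), 0 < η → ∃ N : ℕ, ∀ n m : ℕ, N ≤ n → N ≤ m → ∫⁻ t in Set.Ioo 0 T, ‖UnitAddTorus.mFourierCoeff (Literature.Analysis.FunctionSpaces.EuclideanSpace.complexify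 ∘ u (φ n) t) k - UnitAddTorus.mFourierCoeff (Literature.Analysis.FunctionSpaces.EuclideanSpace.complexify ∘ u (φ m) t) k‖ₑ ^ 3 ≤ η :=
  fun _T _B _u hT hB hu hL3 hmod => exists_subseq_forall_modes_cauchy_L3_of_modulus hT hu hB hL3 hmod

end Summit.AnomalousDissipation.AnomalousDissipation.Theorems.EulerLimitKR

end
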